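import Literature.AnabelianGeometry.EtaleTheta.Discharge.Sec4Prop42SubIvHolds
import HarnessLib

/-!
# [EtTh] Prop. 4.2 (iv), sub-node L07 `ZetaB` — PROVED for EVERY §4 setting (universal closure, law-free),
# and Prop. 4.2 (iv) AS TYPED ⇐ L06 `ZetaA` alone, for every setting

Mochizuki, *The étale theta function and its Frobenioid-theoretic manifestations*, Publ. RIMS **45**
(2009) [EtTh], §4, Proposition 4.2 (iv), statement PDF p.89 L1–12, proof p.90 L12–24
[cite: MochizukiEtTh2009, Prop 4.2 p.89]; the setting of §4, PDF p.86 («whose divisor monoid `Φ` is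
perfect»).

PROOF-ONLY companion (abc-iut cell, block F, seat abc-iut-f-084; FACT-LIST row F-2800 `ZetaB` of the
sub-DAG statements file `Literature/AnabelianGeometry/EtaleTheta/Prop42Sub.lean`, abc-iut-w5-d134).  Nothing
of that file, of `BiKummer.lean` / `BiKummerRoots.lean` (abc-iut-L2-t3), of the conditional theorems of record
(`Discharge/Sec4Prop42Sub.lean`: `exists_zetaB_num`, `exists_zetaB_den`, `zetaB_upto_unit_of`, `zetaB_of`,
all modulo `hΦd` «`Φ` divisorial»; `Discharge/Sec4Prop42SubLawFree.lean`: the same at the canonical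
vocabulary; `Discharge/Sec4Prop42SubHolds.lean`: the instance form `zetaB_holds` at `mkOfModelCanonical`,
abc-iut-f-130) or of abc-iut-f-131's `Discharge/Sec4Prop42SubIvHolds.lean` (`betaCompat_holds`,
`rootUnitTorsion_holds`, IMPORTED) is edited or restated; no `def`, no named fact, no instance, no new
hypothesis.

WHAT IS PROVED.  `zetaB_lawFree`: the sub-node L07 `ZetaB` («the existence of a `ζ_B` … follows from the
equivalences of categories determined by pre-steps of [FrdI], Definition 1.3, (iii), (d)», p.90 L21–23, with
«after possibly replacing `s''_N` by `u ∘ s''_N`, for some `u ∈ μ_N(B_N)`», p.89 L4) holds for EVERY setting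
`S : BiKummerSetting X T D VD` — every base field, every `Π^tp_X`, every Def. 3.6 (i) datum `T`, every base
category `D`, every (opaque) [FrdI] vocabulary `VD` — and every transport `pullFrac`; i.e. its UNIVERSAL
CLOSURE is a theorem.  The proof of record (`zetaB_of`, abc-iut-w5-d134) used the [FrdI] Thm. 5.2 (ii) law
«`Φ` divisorial» at two places only: (1) «`Φ(A_N)` is torsion-free» to get `Div(s'_N) = ζ_A^* Div(s̄'_N)`
from `N · Div(s'_N) = α^* Div(s') = ζ_A^*(ᾱ^* Div(s')) = N · ζ_A^* Div(s̄'_N)`, and (2) `Div(ζ_A) = 0` for the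
isomorphism `ζ_A`.  Both follow WITHOUT that law from the setting's own REAL clause «whose divisor monoid `Φ`
is perfect» (p.86; field `BiKummerSetting.isPerfect`): the `N`-th power map of `Φ(A_N)` is injective
(`pow_injective_of_isPerfect`), which gives (1) directly and (2) from `ζ_A ≫ ᾱ = α` with `α, ᾱ` isometries of
Frobenius degree `N` (`Div(ζ_A)^N = 1`, `div_hom_eq_one_of_comp_eq`).  The isomorphism `ζ_B` is then [FrdI]
Thm. 5.2 (ii)'s `ModelFrobenioid.exists_iso_comp_eq_of_div_eq` (`B` group-like by the structure field
`isUnit_BΛ`), the unit `u` is `ζ_B'' ∘ ζ_B⁻¹`, and «`u ∈ μ_N(B_N)`» is abc-iut-f-131's law-free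
`rootUnitTorsion_holds`.  COROLLARY `prop42_iv_of_zetaA_lawFree`: the typed node
`BiKummerSetting.Prop42_iv` follows from L06 `ZetaA` ALONE, for every setting and every transport (the
composition `prop42_iv_of_subnodes` with `zetaB_lawFree` and f-131's `betaCompat_holds`) — the residual
«`Φ` divisorial» of `prop42_iv_of_isDivisorial_of_zetaA` (p435431) is gone.

HONEST FRAMING: refereed pre-IUT material ([EtTh] 2009, [FrdI] 2008); the row is an intermediate statement OF
THE PRINTED PROOF of Prop. 4.2 (iv) as typed by the cell; typed ≠ proved for the remaining rows of the
sub-DAG (L05/L06); a FACT row is an assumption label; nothing here bears on or takes a side on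
[IUTchIII] Cor. 3.12.
-/

namespace Literature.AnabelianGeometry.EtaleTheta

open CategoryTheory Opposite Literature.AlgebraicGeometry.Frobenioids

universe u₀ v₀ u v w

variable {K : Type u₀} [Field K]

namespace BiKummerSetting

variable {X : SemiGraphs.TemperedArithmeticGroup.{u₀} K} {D₀ : Type u₀} [Category.{v₀} D₀]
  {V : FrdIMonoidStub.{w}} {T : RealifiedDivisorMonoids (D₀ := D₀) V} {D : Type u} [Category.{v} D]
  {VD : FrdICatStub.{u, v, w} D} (S : BiKummerSetting X T D VD)

/-! ## §1. «`Φ` is perfect» (setting of §4, p.86): the `N`-th power map of `Φ(A)` is injective -/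

/-- **«whose divisor monoid `Φ` is perfect»** (setting of §4, p.86; [FrdI] §0: multiplication by every
`N ∈ ℕ_{≥1}` is bijective on `Φ(A)`): `x^N = y^N ⇒ x = y` in `Φ(A)` — for EVERY setting, from the structure
field `isPerfect` (no divisoriality). [cite: MochizukiEtTh2009, Def 4.1 p.86] -/
theorem pow_injective_of_isPerfect (A : Dᵒᵖ) (N : ℕ+) {x y : S.tf.divisorMonoid.obj A}
    (h : x ^ (N : ℕ) = y ^ (N : ℕ)) : x = y :=
  ((S.isPerfect A).bijective_pow (N : ℕ) N.pos).1 h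

namespace Prop42Sub

variable (pullFrac : ∀ {A A' : S.C} (_ : A' ⟶ A), S.biratUnits A → S.biratUnits A')

/-! ## §2. `Div(ζ_A) = 0` for an isomorphism `ζ_A` over `α, ᾱ` -/

/-- For two `N`-th roots `R, R'` and an isomorphism `ζ_A : A_N ⥲ Ā_N` with `ᾱ ∘ ζ_A = α`:
**`Div(ζ_A) = 0`** — reading the zero divisors of `ᾱ ∘ ζ_A = α` ([FrdI] Thm. 5.2 (i):
`Div(ᾱ ∘ ζ_A) = ζ_A^* Div(ᾱ) + N · Div(ζ_A)`) with `α, ᾱ` isometries of Frobenius degree `N` gives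
`N · Div(ζ_A) = 0`, and `Φ(A_N)` is perfect. [cite: MochizukiEtTh2009, Prop 4.2 p.90] -/
theorem div_zetaA_eq_one {B : S.C} {f : S.biratUnits S.Aodot} {P : S.FractionPair f B} {N : ℕ+}
    (R R' : S.NthRoot f P N pullFrac) (ζA : R.AN ≅ R'.AN) (hζ : ζA.hom ≫ R'.α = R.α) :
    ModelFrobenioid.div ζA.hom = 1 := by
  have hα : ModelFrobenioid.div R.α = 1 := R.isIsometry.1
  have hα' : ModelFrobenioid.div R'.α = 1 := R'.isIsometry.1
  have hN' : ModelFrobenioid.degFr R'.α = N := R'.isIsometry.2.2.1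
  have e := congrArg ModelFrobenioid.div hζ
  rw [ModelFrobenioid.div_comp_pull, hα', map_one, one_mul, hN', hα] at e
  exact S.pow_injective_of_isPerfect (op R.AN.base) N (e.trans (one_pow _).symm)

/-- Hence `Div(s ∘ ζ_A) = ζ_A^* Div(s)` for every `s` out of `Ā_N`. [cite: MochizukiEtTh2009, Prop 4.2 p.90] -/
theorem div_zetaA_comp {B : S.C} {f : S.biratUnits S.Aodot} {P : S.FractionPair f B} {N : ℕ+}
    (R R' : S.NthRoot f P N pullFrac) (ζA : R.AN ≅ R'.AN) (hζ : ζA.hom ≫ R'.α = R.α)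
    {Z : S.C} (s : R'.AN ⟶ Z) :
    ModelFrobenioid.div (ζA.hom ≫ s) =
      pull S.tf.divisorMonoid (ModelFrobenioid.baseMap ζA.hom) (ModelFrobenioid.div s) := by
  rw [ModelFrobenioid.div_comp_pull, div_zetaA_eq_one S pullFrac R R' ζA hζ, one_pow, mul_one]

/-! ## §3. L07 up to its `μ_N`-clause, law-free: the isomorphism `ζ_B` and the unit `u` -/

/-- **(iv)/L07, the [FrdI] Def. 1.3 (iii)(d) half — for EVERY setting**: given `ζ_A` over `α, ᾱ`, the
isomorphism `ζ_B : B_N ⥲ B̄_N` with `s̄'_N ∘ ζ_A = ζ_B ∘ s'_N` EXISTS — `N · Div(s'_N) = α^* Div(s') =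
ζ_A^*(ᾱ^* Div(s')) = N · ζ_A^* Div(s̄'_N)` and `Φ(A_N)` is PERFECT, so the two pre-steps `s'_N`, `s̄'_N ∘ ζ_A`
out of `A_N` have the same divisor ([FrdI] Thm. 5.2 (ii): `ModelFrobenioid.exists_iso_comp_eq_of_div_eq`, `B`
group-like by `isUnit_BΛ`). [cite: MochizukiEtTh2009, Prop 4.2 p.90] -/
theorem exists_zetaB_num_lawFree {B : S.C} {f : S.biratUnits S.Aodot} {P : S.FractionPair f B} {N : ℕ+}
    (R R' : S.NthRoot f P N pullFrac) (ζA : R.AN ≅ R'.AN) (hζ : ζA.hom ≫ R'.α = R.α) :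
    ∃ ζB : R.BN ≅ R'.BN, ζA.hom ≫ R'.pair.num = R.pair.num ≫ ζB.hom := by
  haveI : IsIso (ModelFrobenioid.baseMap R.pair.num) := R.pair.isPreStep_num.2
  haveI : IsIso (ModelFrobenioid.baseMap R'.pair.num) := R'.pair.isPreStep_num.2
  haveI : IsIso (ModelFrobenioid.baseMap (ζA.hom ≫ R'.pair.num)) := by
    rw [ModelFrobenioid.baseMap_comp]
    haveI : IsIso (ModelFrobenioid.baseMap ζA.hom) := ModelFrobenioid.isIso_baseMap_of_isIso ζA.hom
    infer_instance
  have hn : ModelFrobenioid.degFr R.pair.num = 1 := R.pair.isPreStep_num.1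
  have hn' : ModelFrobenioid.degFr R'.pair.num = 1 := R'.pair.isPreStep_num.1
  have hdeg : ModelFrobenioid.degFr R.pair.num = ModelFrobenioid.degFr (ζA.hom ≫ R'.pair.num) := by
    rw [ModelFrobenioid.degFr_comp, ModelFrobenioid.degFr_eq_one_of_isIso ζA.hom, mul_one, hn, hn']
  have hdiv : ModelFrobenioid.div R.pair.num = ModelFrobenioid.div (ζA.hom ≫ R'.pair.num) := by
    apply S.pow_injective_of_isPerfect (op R.AN.base) N
    rw [R.div_num_pow, div_zetaA_comp S pullFrac R R' ζA hζ, ← map_pow, R'.div_num_pow, ← pull_comp,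
      ← ModelFrobenioid.baseMap_comp, hζ]
  obtain ⟨v, hv⟩ := ModelFrobenioid.exists_iso_comp_eq_of_div_eq
    (S.tf.isGroupLike_ratFnFunctor T.isUnit_BΛ) R.pair.num (ζA.hom ≫ R'.pair.num) hdeg hdiv
  exact ⟨v, hv.symm⟩

/-- The same for the denominators, for EVERY setting: `ζ_B'' : B_N ⥲ B̄_N` with
`s̄''_N ∘ ζ_A = ζ_B'' ∘ s''_N`. [cite: MochizukiEtTh2009, Prop 4.2 p.90] -/
theorem exists_zetaB_den_lawFree {B : S.C} {f : S.biratUnits S.Aodot} {P : S.FractionPair f B} {N : ℕ+}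
    (R R' : S.NthRoot f P N pullFrac) (ζA : R.AN ≅ R'.AN) (hζ : ζA.hom ≫ R'.α = R.α) :
    ∃ ζB : R.BN ≅ R'.BN, ζA.hom ≫ R'.pair.den = R.pair.den ≫ ζB.hom := by
  haveI : IsIso (ModelFrobenioid.baseMap R.pair.den) := R.pair.isPreStep_den.2
  haveI : IsIso (ModelFrobenioid.baseMap R'.pair.den) := R'.pair.isPreStep_den.2
  haveI : IsIso (ModelFrobenioid.baseMap (ζA.hom ≫ R'.pair.den)) := by
    rw [ModelFrobenioid.baseMap_comp]
    haveI : IsIso (ModelFrobenioid.baseMap ζA.hom) := ModelFrobenioid.isIso_baseMap_of_isIso ζA.hom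
    infer_instance
  have hn : ModelFrobenioid.degFr R.pair.den = 1 := R.pair.isPreStep_den.1
  have hn' : ModelFrobenioid.degFr R'.pair.den = 1 := R'.pair.isPreStep_den.1
  have hdeg : ModelFrobenioid.degFr R.pair.den = ModelFrobenioid.degFr (ζA.hom ≫ R'.pair.den) := by
    rw [ModelFrobenioid.degFr_comp, ModelFrobenioid.degFr_eq_one_of_isIso ζA.hom, mul_one, hn, hn']
  have hdiv : ModelFrobenioid.div R.pair.den = ModelFrobenioid.div (ζA.hom ≫ R'.pair.den) := by
    apply S.pow_injective_of_isPerfect (op R.AN.base) N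
    rw [R.div_den_pow, div_zetaA_comp S pullFrac R R' ζA hζ, ← map_pow, R'.div_den_pow, ← pull_comp,
      ← ModelFrobenioid.baseMap_comp, hζ]
  obtain ⟨v, hv⟩ := ModelFrobenioid.exists_iso_comp_eq_of_div_eq
    (S.tf.isGroupLike_ratFnFunctor T.isUnit_BΛ) R.pair.den (ζA.hom ≫ R'.pair.den) hdeg hdiv
  exact ⟨v, hv.symm⟩

/-- **(iv)/L07 up to the `μ_N`-clause — for EVERY setting**: given `ζ_A` over `α, ᾱ` there are
`ζ_B : B_N ⥲ B̄_N` and a UNIT `u ∈ O^×(B_N)` with `s̄'_N ∘ ζ_A = ζ_B ∘ s'_N` and `s̄''_N ∘ ζ_A = ζ_B ∘ u ∘ s''_N`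
(`u := ζ_B'' ∘ ζ_B⁻¹` for the two isomorphisms above; same base because `s'_N, s''_N` and `s̄'_N, s̄''_N` are
base-equivalent). [cite: MochizukiEtTh2009, Prop 4.2 p.90] -/
theorem zetaB_upto_unit_lawFree {B : S.C} {f : S.biratUnits S.Aodot} {P : S.FractionPair f B} {N : ℕ+}
    (R R' : S.NthRoot f P N pullFrac) (ζA : R.AN ≅ R'.AN) (hζ : ζA.hom ≫ R'.α = R.α) :
    ∃ (u : Aut R.BN) (ζB : R.BN ≅ R'.BN), u ∈ S.units R.BN ∧
      ζA.hom ≫ R'.pair.num = R.pair.num ≫ ζB.hom ∧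
        ζA.hom ≫ R'.pair.den = (R.pair.den ≫ u.hom) ≫ ζB.hom := by
  obtain ⟨ζB, hB⟩ := exists_zetaB_num_lawFree S pullFrac R R' ζA hζ
  obtain ⟨ζB'', hB''⟩ := exists_zetaB_den_lawFree S pullFrac R R' ζA hζ
  haveI : IsIso (ModelFrobenioid.baseMap R.pair.num) := R.pair.isPreStep_num.2
  have hbase : ModelFrobenioid.baseMap ζB''.hom = ModelFrobenioid.baseMap ζB.hom := by
    have h1 := congrArg ModelFrobenioid.baseMap hB
    have h2 := congrArg ModelFrobenioid.baseMap hB''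
    rw [ModelFrobenioid.baseMap_comp, ModelFrobenioid.baseMap_comp] at h1 h2
    have hRb : ModelFrobenioid.baseMap R.pair.den = ModelFrobenioid.baseMap R.pair.num := R.pair.base_eq.symm
    have hR'b : ModelFrobenioid.baseMap R'.pair.den = ModelFrobenioid.baseMap R'.pair.num :=
      R'.pair.base_eq.symm
    rw [hRb, hR'b] at h2
    exact (cancel_epi (ModelFrobenioid.baseMap R.pair.num)).mp (h2.symm.trans h1)
  refine ⟨ζB'' ≪≫ ζB.symm, ζB, ?_, hB, ?_⟩
  · have hu := ModelFrobenioid.trans_symm_mem_units ζB'' ζB hbase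
    exact ⟨hu.1, hu.2⟩
  · rw [Iso.trans_hom, Iso.symm_hom, Category.assoc, Category.assoc, Iso.inv_hom_id, Category.comp_id]
    exact hB''

/-! ## §4. L07 `ZetaB` for every setting — the FACT-LIST row's universal closure (F-2800) -/

/-- **(iv)/L07 `ZetaB` — PROVED for every setting and every transport** (F-2800): «the existence of a `ζ_B`
… follows from the equivalences of categories determined by pre-steps of [FrdI], Definition 1.3, (iii), (d)»
(p.90 L21–23), «after possibly replacing `s''_N` by `u ∘ s''_N`, for some `u ∈ μ_N(B_N)`» (p.89 L4): `ζ_B` and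
the unit `u` by `zetaB_upto_unit_lawFree` («`Φ` perfect» only), `u^N = 1` by abc-iut-f-131's law-free
`rootUnitTorsion_holds`.  Conclusion spelled with the fully-qualified row name.
[cite: MochizukiEtTh2009, Prop 4.2 p.90] -/
theorem zetaB_lawFree :
    Literature.AnabelianGeometry.EtaleTheta.BiKummerSetting.Prop42Sub.ZetaB S pullFrac := by
  intro B f P N R R' ζA hζ
  obtain ⟨u, ζB, hu, hnum, hden⟩ := zetaB_upto_unit_lawFree S pullFrac R R' ζA hζ
  exact ⟨⟨u, hu, rootUnitTorsion_holds S pullFrac f P N R R' ζA ζB u hu hζ hnum hden⟩, ζB, hnum, hden⟩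

/-- `Literature.AnabelianGeometry.EtaleTheta.BiKummerSetting.Prop42Sub.ZetaB` holds for all
parameters — `_holds` alias of `zetaB_lawFree` above (appended 2026-08-28, D-0026 bookkeeping:
the proof term is the existing theorem of this file; no statement, definition or attribute is
edited; no new named fact).
[cite: MochizukiEtTh2009, Prop 4.2 p.90] -/
theorem _root_.Literature.AnabelianGeometry.EtaleTheta.BiKummerSetting.Prop42Sub.ZetaB_holds :
    Literature.AnabelianGeometry.EtaleTheta.BiKummerSetting.Prop42Sub.ZetaB S pullFrac :=
  zetaB_lawFree S pullFrac

/-- **The universal closure of the row, every binder explicit** (F-2800; every base field `K`, every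
`Π^tp_X`, every Def. 3.6 (i) datum, every base category, every opaque [FrdI] vocabulary `V`/`VD`, every
setting, every transport). [cite: MochizukiEtTh2009, Prop 4.2 p.90] -/
theorem forall_zetaB :
    ∀ {K : Type u₀} [Field K] {X : SemiGraphs.TemperedArithmeticGroup.{u₀} K} {D₀ : Type u₀}
      [Category.{v₀} D₀] {V : FrdIMonoidStub.{w}} {T : RealifiedDivisorMonoids (D₀ := D₀) V} {D : Type u}
      [Category.{v} D] {VD : FrdICatStub.{u, v, w} D} (S : BiKummerSetting X T D VD)
      (pullFrac : ∀ {A A' : S.C} (_ : A' ⟶ A), S.biratUnits A → S.biratUnits A'),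
      Literature.AnabelianGeometry.EtaleTheta.BiKummerSetting.Prop42Sub.ZetaB S pullFrac :=
  fun S pullFrac => zetaB_lawFree S pullFrac

/-! ## §5. Prop. 4.2 (iv) AS TYPED ⇐ L06 `ZetaA` alone, for every setting -/

/-- **[EtTh] Prop. 4.2 (iv) AS TYPED ⇐ L06 `ZetaA` ALONE — for EVERY setting (every [FrdI] vocabulary) and
every transport, with NO structural law and no birational dictionary**: the composition
`prop42_iv_of_subnodes` (abc-iut-w5-d134) with L07 = `zetaB_lawFree` and L08 = abc-iut-f-131's
`betaCompat_holds`.  (L06 is [FrdI] Prop. 5.6 + Rmk. 4.1.1 + [FrdI] Thm. 5.1 (iii) in print, p.90 L17–21; it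
consumes L05 / the roots-of-constants law at the `(N, H)`-slot.) [cite: MochizukiEtTh2009, Prop 4.2 p.89] -/
theorem prop42_iv_of_zetaA_lawFree (h₆ : ZetaA S pullFrac) :
    Literature.AnabelianGeometry.EtaleTheta.BiKummerSetting.Prop42_iv S pullFrac :=
  prop42_iv_of_subnodes S pullFrac h₆ (zetaB_lawFree S pullFrac) (betaCompat_holds S pullFrac)

end Prop42Sub

end BiKummerSetting

end Literature.AnabelianGeometry.EtaleTheta
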